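import Literature.NumberTheory.Automorphic.IdeleClassGroupFirstCohomology
import Mathlib.GroupTheory.Solvable
import HarnessLib

/-!
# `H¹(Gal(E/F), C_E) = 0` for every SOLVABLE Galois group, in cocycle form
# (Tate, Cassels–Fröhlich Ch. VII §9 Thm. 9.1, the solvable step of its proof)

Topic `NumberTheory/Automorphic` (ideles, idele classes); namespace
`Literature.NumberTheory.Automorphic.IdeleClassGroup`.  Proof file: theorems only (no definition, no named
fact, no instance; D-0026).  Sequel to `IdeleClassGroupFirstCohomology` (cyclic layers, Galois descent of
idele classes, one inflation–restriction step).

* §1 **`exists_normal_ne_top_isCyclic_quotient`** — a finite solvable non-trivial group has a proper normal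
  subgroup with cyclic quotient (a maximal proper subgroup containing the commutator subgroup; group theory,
  the engine of "induction over a solvable group by cyclic steps").
* §2 **`exists_classGalAct_div_eq_of_isSolvable`** — for a finite Galois extension of number fields `E/F`
  with SOLVABLE Galois group (in particular every abelian extension and every extension of prime-power
  degree), every crossed homomorphism `Gal(E/F) → C_E`, `f (g h) = g • f h · f g`, is a coboundary
  `g ↦ g • c / c`: `H¹(Gal(E/F), C_E) = 0`.  Induction on `#Gal(E/F)`: for `N ◁ G` proper with `G/N` cyclic and
  `M = E^N`, `Gal(M/F) ≅ G/N` is cyclic (`IsGalois.normalAutEquivQuotient`) so `H¹(Gal(M/F), C_M) = 0`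
  (`exists_classGalAct_div_eq_of_isCyclic`), `Gal(E/M) ≅ N` is solvable of smaller order so
  `H¹(Gal(E/M), C_E) = 0` by induction, and the inflation–restriction step
  (`exists_classGalAct_div_eq_of_tower`) concludes.

Not here: the Sylow / corestriction step from solvable to arbitrary Galois groups (Tate, loc. cit.,
"because of the Sylow subgroup argument it suffices to treat `p`-groups").

## References

* J. W. S. Cassels, A. Fröhlich (eds.), *Algebraic Number Theory* (1967), Ch. VII (J. Tate) §9 Thm. 9.1
  and its proof. [CasselsFrohlichANT1967]
* J.-P. Serre, *Local Fields*, GTM 67 (1979), Ch. VII §6 (inflation–restriction), Ch. IX §1 (solvable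
  groups: composition series with cyclic quotients). [SerreLocalFields1979]
-/

noncomputable section

open NumberField
open scoped NumberField

namespace Literature.NumberTheory.Automorphic

namespace IdeleClassGroup

open Literature.NumberTheory.GaloisRepresentations
open Literature.Algebra.Homology

/-! ## §1. A finite solvable non-trivial group has a proper normal subgroup with cyclic quotient -/

section GroupTheory

/-- **A finite solvable group `G ≠ 1` has a normal subgroup `N ≠ G` with `G/N` cyclic.**  Take `N`
maximal among the proper subgroups containing the commutator subgroup `G'` (`G' ≠ G` by solvability):
`N` is normal, and a non-trivial element of `G/N` generates it by maximality.
[cite: SerreLocalFields1979, Ch. IX §1 (solvable groups, composition series with cyclic quotients)] -/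
theorem exists_normal_ne_top_isCyclic_quotient (G : Type*) [Group G] [Finite G] [IsSolvable G]
    [Nontrivial G] : ∃ N : Subgroup G, ∃ _ : N.Normal, N ≠ ⊤ ∧ IsCyclic (G ⧸ N) := by
  classical
  haveI : Finite (Subgroup G) := Finite.of_injective _ SetLike.coe_injective
  set S : Set (Subgroup G) := {B | commutator G ≤ B ∧ B ≠ ⊤} with hS
  have hne : S.Nonempty := ⟨commutator G, le_rfl, (IsSolvable.commutator_lt_top_of_nontrivial G).ne⟩
  obtain ⟨B, ⟨hcB, hBt⟩, hmax⟩ := (Set.toFinite S).exists_maximal hne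
  -- `B` is normal since it contains the commutator subgroup
  have hBn : B.Normal := ⟨fun b hb g => by
    have hc : g * b * g⁻¹ * b⁻¹ ∈ B :=
      hcB (Subgroup.commutator_mem_commutator (Subgroup.mem_top g) (Subgroup.mem_top b))
    have : g * b * g⁻¹ = g * b * g⁻¹ * b⁻¹ * b := by rw [inv_mul_cancel_right]
    rw [this]
    exact B.mul_mem hc hb⟩
  refine ⟨B, hBn, hBt, ?_⟩
  -- a non-trivial element of `G ⧸ B` generates
  obtain ⟨g, -, hg⟩ : ∃ g : G, g ∈ (⊤ : Subgroup G) ∧ g ∉ B := SetLike.exists_of_lt hBt.lt_top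
  refine ⟨⟨(g : G ⧸ B), fun y => ?_⟩⟩
  set C : Subgroup G := (Subgroup.zpowers (g : G ⧸ B)).comap (QuotientGroup.mk' B) with hC
  have hBC : B ≤ C := fun b hb => by
    change (b : G ⧸ B) ∈ Subgroup.zpowers (g : G ⧸ B)
    rw [(QuotientGroup.eq_one_iff b).mpr hb]
    exact one_mem _
  have hCtop : C = ⊤ := by
    by_contra hCt
    have hCS : C ∈ S := ⟨hcB.trans hBC, hCt⟩
    have hCB : C ≤ B := hmax hCS hBC
    exact hg (hCB (show g ∈ C from Subgroup.mem_zpowers (g : G ⧸ B)))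
  obtain ⟨x, rfl⟩ := QuotientGroup.mk_surjective y
  have hx : x ∈ C := hCtop ▸ Subgroup.mem_top x
  exact hx

end GroupTheory

/-! ## §2. Solvable layers -/

section Solvable

/-- Induction on the order of the Galois group (auxiliary form of
`exists_classGalAct_div_eq_of_isSolvable`). [cite: CasselsFrohlichANT1967, Ch. VII §9 Thm. 9.1 (proof)] -/
theorem exists_classGalAct_div_eq_of_isSolvable_aux (n : ℕ) :
    ∀ (F E : Type) [Field F] [Field E] [Algebra F E] [NumberField F] [NumberField E] [IsGalois F E]
      [IsSolvable (E ≃ₐ[F] E)], Nat.card (E ≃ₐ[F] E) = n →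
      ∀ f : (E ≃ₐ[F] E) → IdeleClassGroup E, (∀ g h, f (g * h) = classGalAct g (f h) * f g) →
        ∃ c : IdeleClassGroup E, ∀ g, classGalAct g c / c = f g := by
  induction n using Nat.strong_induction_on with
  | _ n ih =>
  intro F E _ _ _ _ _ _ _ hn f hf
  classical
  by_cases htriv : Subsingleton (E ≃ₐ[F] E)
  · -- trivial group: `f = 1`
    refine ⟨1, fun g => ?_⟩
    have h1 : f 1 = 1 := CrossedHomElem.map_one_of_crossed
      (fun g : E ≃ₐ[F] E => (classGalAct g : IdeleClassGroup E →ₜ* IdeleClassGroup E).toMonoidHom)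
      classGalAct_toMonoidHom_one hf
    rw [Subsingleton.elim g 1, h1, map_one]
    exact div_one _
  · haveI : Nontrivial (E ≃ₐ[F] E) := not_subsingleton_iff_nontrivial.mp htriv
    obtain ⟨N, hNn, hNt, hcyc⟩ := exists_normal_ne_top_isCyclic_quotient (E ≃ₐ[F] E)
    haveI := hcyc
    -- the intermediate field `M = E^N`: `M/F` cyclic, `E/M` Galois solvable of smaller order
    haveI : IsCyclic ((IntermediateField.fixedField N) ≃ₐ[F] (IntermediateField.fixedField N)) :=
      isCyclic_of_surjective (IsGalois.normalAutEquivQuotient N) (IsGalois.normalAutEquivQuotient N).surjective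
    haveI : IsGalois (IntermediateField.fixedField N) E :=
      IsGalois.tower_top_of_isGalois F (IntermediateField.fixedField N) E
    haveI : IsSolvable (E ≃ₐ[IntermediateField.fixedField N] E) :=
      solvable_of_surjective (f := (IntermediateField.subgroupEquivAlgEquiv N).toMonoidHom)
        (IntermediateField.subgroupEquivAlgEquiv N).surjective
    have hcard : Nat.card (E ≃ₐ[IntermediateField.fixedField N] E) < n := by
      rw [← Nat.card_congr (IntermediateField.subgroupEquivAlgEquiv N).toEquiv, ← hn]
      exact lt_of_le_of_ne (Subgroup.card_le_card_group N) fun h => hNt ((Subgroup.card_eq_iff_eq_top N).mp h)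
    exact exists_classGalAct_div_eq_of_tower (F := F) (M := IntermediateField.fixedField N) (E := E)
      (fun f' hf' => ih _ hcard (IntermediateField.fixedField N) E rfl f' hf')
      (fun f' hf' => exists_classGalAct_div_eq_of_isCyclic f' hf') f hf

/-- **`H¹(Gal(E/F), C_E) = 0` for every finite Galois extension of number fields with SOLVABLE Galois
group, cocycle form** (Tate, Cassels–Fröhlich Ch. VII §9 Thm. 9.1 — the solvable case of its proof, by
induction through cyclic quotients and inflation–restriction; covers all abelian and all prime-power-degree
layers): every crossed homomorphism `f : Gal(E/F) → C_E`, `f (g h) = g • f h · f g`, is a coboundary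
`f g = g • c / c`. [cite: CasselsFrohlichANT1967, Ch. VII §9 Thm. 9.1] -/
theorem exists_classGalAct_div_eq_of_isSolvable {F E : Type} [Field F] [Field E] [Algebra F E]
    [NumberField F] [NumberField E] [IsGalois F E] [IsSolvable (E ≃ₐ[F] E)]
    (f : (E ≃ₐ[F] E) → IdeleClassGroup E) (hf : ∀ g h, f (g * h) = classGalAct g (f h) * f g) :
    ∃ c : IdeleClassGroup E, ∀ g, classGalAct g c / c = f g :=
  exists_classGalAct_div_eq_of_isSolvable_aux _ F E rfl f hf

end Solvable

end IdeleClassGroup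

end Literature.NumberTheory.Automorphic

end
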